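import Mathlib.Algebra.MvPolynomial.PDeriv
import Mathlib.Algebra.MvPolynomial.CommRing
import Mathlib.LinearAlgebra.Matrix.Determinant.Basic
import Mathlib.Analysis.Complex.Exponential
import HarnessLib

/-!
# Exponentially algebraic complex numbers: Kirby's countable core `E = ecl(∅) ⊂ ℂ`

This is the LIGHT, Mathlib-only file of the notion (requested by route
`Summits/Schanuel/Schanuel/Theses/DiophantineCore`, items `THOnExpAlgebraic`, `BakerOnExpAlgebraic`):

* `Literature.NumberTheory.Transcendental.IsExpAlgebraic a` — the complex number `a` is
  *exponentially algebraic* (over `∅`, in `ℂ_exp`): `a` is a coordinate of a non-degenerate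
  solution `z ∈ ℂᵐ` of a Khovanskii system over `ℤ`, i.e. of `m` polynomial equations
  `f_k(z, e^z) = 0`, `f_k ∈ ℤ[X₁,…,Xₘ,Y₁,…,Yₘ]`, whose Jacobian `det (∂f_k/∂zⱼ)(z, e^z)` — taken by
  the chain rule `∂/∂zⱼ = ∂/∂Xⱼ + Yⱼ ∂/∂Yⱼ` — does not vanish (Kirby 2010, Def. 3.1–3.2 with
  `C = ∅`, and Remark 3.4: "there are only countably many exponentially algebraic numbers";
  Zilber 2005 §5);
* `Literature.NumberTheory.Transcendental.expAlgebraicNumbers : Set ℂ` — the set `E` of such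
  numbers;
* unfolding lemmas and the two facts provable from Mathlib alone that routes use to populate
  `E` by hand: every coordinate of a non-degenerate integer Khovanskii solution is in `E`
  (`IsExpAlgebraic.of_solution`), and `ℤ ⊆ E` (`isExpAlgebraic_intCast`, one equation
  `X - c = 0`).

The body of `IsExpAlgebraic` is, symbol for symbol, the block inlined in the route items
(`∃ (m : ℕ) (z : Fin m → ℂ) (f : Fin m → MvPolynomial (Fin m ⊕ Fin m) ℂ), (∃ k, z k = a) ∧ …`), so
the hypothesis `∀ i, <block with a := x i>` of those items is `∀ i, IsExpAlgebraic (x i)` by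
`Iff.rfl`.

## The bridge to the tree's `ecl` (sibling proof file)

The tree already has Kirby's exponential-algebraic closure operator
`Literature.NumberTheory.Transcendental.ecl (A : Set K)` for any exponential field `K`
(`ZilberField.lean`) with its pregeometry / E-subfield / countability API
(`EclPregeometryProofs.lean`, `EclClosureOperatorProofs.lean`, `ZilberFieldCCP.lean`). The present
definition is exactly `ecl (∅ : Set ℂ)` for `ℂ_exp = (ℂ, Complex.exp)`, unbundled to Mathlib
constants only (`Subring.closure ∅ = ⊥`, whose members are the integer casts; the E-ring `exp` of
`ℂ` is `Complex.exp` by `rfl`; `expPDeriv` unfolded) so that route files naming it import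
nothing from `Literature`. The identification
`expAlgebraicNumbers = ecl (∅ : Set ℂ)` and the re-exported closure API (`E` is a countable
subfield of `ℂ` closed under `exp` and `log` and containing `ℚ̄ ∩ ℂ`, `π`, `e`, `log 2`, …) live in
the sibling file `ExpAlgebraicNumbersProofs.lean`, which imports the `ecl` theory; nothing there
is restated here.

## Mathlib search

Mathlib (this pin) has `MvPolynomial.pderiv`, `MvPolynomial.eval`, `Matrix.det`, `Complex.exp`,
but no exponential rings, Khovanskii systems or exponential algebraicity
(`lean search 'IsExpAlgebraic|expAlgebraic|Khovanskii'` finds only this project's files); the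
o-minimal notion `Literature.ModelTheory.ExponentialFields.RealExpModel.IsExpAlgebraicPointOver`
(`Wilkie1989.lean`, exponential-algebraic points over an ordered E-subfield, for `ℝ_exp`-models)
is a different, relative and first-order notion and is not reused.

## References

* [Kirby2010EAEF] J. Kirby, *Exponential algebraicity in exponential fields*, Bull. Lond. Math.
  Soc. 42 (2010) 879–890 = arXiv:0810.4285: §3, Def. 3.1 (Khovanskii system), Def. 3.2 (`ecl`,
  "exponentially algebraic"), Lemma 3.3, Remark 3.4 (arXiv p. 5).
* [Zilber2005PseudoExp] B. Zilber, *Pseudo-exponentiation on algebraically closed fields of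
  characteristic zero*, Ann. Pure Appl. Logic 132 (2005) 67–95, §5.
-/

namespace Literature.NumberTheory.Transcendental

open MvPolynomial

/-- A complex number `a` is **exponentially algebraic** (it lies in Kirby's countable core
`E = ecl^{ℂ_exp}(∅)`): there are `m ∈ ℕ`, a point `z ∈ ℂᵐ` having `a` as one of its coordinates,
and `m` polynomials `f_k ∈ ℂ[X₁,…,Xₘ,Y₁,…,Yₘ]` (`X = Sum.inl`, `Y = Sum.inr` variables) with
INTEGER coefficients such that `z` is a non-degenerate solution of the Khovanskii system
`f_k(z, e^z) = 0` (`k < m`): every `f_k` vanishes at `(z, exp z)` and the Jacobian matrix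
`(∂f_k/∂zⱼ)(z, e^z)`, computed by the chain rule `∂/∂zⱼ f(z, e^z) = (∂_{Xⱼ} f + Yⱼ ∂_{Yⱼ} f)(z, e^z)`,
has non-zero determinant. This is Kirby's `a ∈ ecl(∅)` (Def. 3.2: "if `a ∈ ecl^R(C)` we say that
`a` is exponentially algebraic over `C` in `R`") for `R = ℂ_exp`, `C = ∅`, in the normal form
used by the tree's `Literature.NumberTheory.Transcendental.ecl` (`ZilberField.lean`): exponential
polynomials are replaced by ordinary polynomials in `(z, e^z)` (extra unknowns absorb iterated
exponentials) and the coefficient ring is `ℤ = Subring.closure ∅` (extra unknowns absorb the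
exponential constants `e, e^e, …` of the E-subring generated by `∅`; both normalisations are
harmless because `E` is an `ecl`-closed E-subfield, Kirby Lemma 3.3). It is NOT an `abbrev` of
`ecl (∅ : Set ℂ)` only to keep this file's import cone inside Mathlib; the identification
`IsExpAlgebraic a ↔ a ∈ ecl (∅ : Set ℂ)` is the kernel-checked lemma
`isExpAlgebraic_iff_mem_ecl_empty` of the sibling proof file (the two bodies agree up to
`Subring.closure_empty`/`Subring.mem_bot` and two `rfl`s).
[cite: Kirby2010EAEF, §3 Def. 3.1–3.2 and Remark 3.4] -/
def IsExpAlgebraic (a : ℂ) : Prop :=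
  ∃ (m : ℕ) (z : Fin m → ℂ) (f : Fin m → MvPolynomial (Fin m ⊕ Fin m) ℂ), (∃ k, z k = a) ∧
    (∀ k mo, ∃ c : ℤ, (c : ℂ) = (f k).coeff mo) ∧
    (∀ k, MvPolynomial.eval (Sum.elim z (Complex.exp ∘ z)) (f k) = 0) ∧
    (Matrix.of fun k j => MvPolynomial.eval (Sum.elim z (Complex.exp ∘ z))
      (MvPolynomial.pderiv (Sum.inl j) (f k) +
        MvPolynomial.X (Sum.inr j) * MvPolynomial.pderiv (Sum.inr j) (f k))).det ≠ 0

/-- The set `E ⊆ ℂ` of exponentially algebraic numbers (Kirby's `ecl(∅)` in `ℂ_exp`; Zilber 2005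
§5). It is countable (Kirby 2010, Remark 3.4) and an `exp`/`log`-closed subfield (Lemma 3.3); see
the sibling proof file. [cite: Kirby2010EAEF, §3 Def. 3.2 and Remark 3.4] -/
def expAlgebraicNumbers : Set ℂ :=
  {a | IsExpAlgebraic a}

/-- Membership in `expAlgebraicNumbers` is `IsExpAlgebraic` (by definition).
[cite: Kirby2010EAEF, §3 Def. 3.2] -/
@[simp] theorem mem_expAlgebraicNumbers {a : ℂ} : a ∈ expAlgebraicNumbers ↔ IsExpAlgebraic a :=
  Iff.rfl

/-- Unfolding lemma: `IsExpAlgebraic a` is literally the Khovanskii-system block inlined in the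
route items (so `∀ i, <block at x i>` there is `∀ i, IsExpAlgebraic (x i)` by `Iff.rfl`).
[cite: Kirby2010EAEF, §3 Def. 3.1–3.2] -/
theorem isExpAlgebraic_iff (a : ℂ) :
    IsExpAlgebraic a ↔
      ∃ (m : ℕ) (z : Fin m → ℂ) (f : Fin m → MvPolynomial (Fin m ⊕ Fin m) ℂ), (∃ k, z k = a) ∧
        (∀ k mo, ∃ c : ℤ, (c : ℂ) = (f k).coeff mo) ∧
        (∀ k, MvPolynomial.eval (Sum.elim z (Complex.exp ∘ z)) (f k) = 0) ∧
        (Matrix.of fun k j => MvPolynomial.eval (Sum.elim z (Complex.exp ∘ z))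
          (MvPolynomial.pderiv (Sum.inl j) (f k) +
            MvPolynomial.X (Sum.inr j) * MvPolynomial.pderiv (Sum.inr j) (f k))).det ≠ 0 :=
  Iff.rfl

/-- Every coordinate of a non-degenerate solution of an integer Khovanskii system is
exponentially algebraic (the introduction rule of the definition, Kirby Def. 3.2).
[cite: Kirby2010EAEF, §3 Def. 3.2] -/
theorem IsExpAlgebraic.of_solution {m : ℕ} {z : Fin m → ℂ}
    {f : Fin m → MvPolynomial (Fin m ⊕ Fin m) ℂ}
    (hcoeff : ∀ k mo, ∃ c : ℤ, (c : ℂ) = (f k).coeff mo)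
    (heval : ∀ k, MvPolynomial.eval (Sum.elim z (Complex.exp ∘ z)) (f k) = 0)
    (hdet : (Matrix.of fun k j => MvPolynomial.eval (Sum.elim z (Complex.exp ∘ z))
      (MvPolynomial.pderiv (Sum.inl j) (f k) +
        MvPolynomial.X (Sum.inr j) * MvPolynomial.pderiv (Sum.inr j) (f k))).det ≠ 0)
    (k : Fin m) : IsExpAlgebraic (z k) :=
  ⟨m, z, f, ⟨k, rfl⟩, hcoeff, heval, hdet⟩

/-- Integers are exponentially algebraic: `c` solves the one-unknown Khovanskii system
`X₁ - c = 0`, whose Jacobian is `1` (Kirby 2010, Lemma 3.3: `ecl C` is a subring).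
[cite: Kirby2010EAEF, §3 Lemma 3.3] -/
theorem isExpAlgebraic_intCast (c : ℤ) : IsExpAlgebraic (c : ℂ) := by
  classical
  refine ⟨1, fun _ => (c : ℂ), fun _ => X (Sum.inl 0) - C (c : ℂ), ⟨0, rfl⟩, ?_, ?_, ?_⟩
  · intro k mo
    rw [coeff_sub, coeff_X, coeff_C]
    split_ifs
    · exact ⟨1 - c, by push_cast; ring⟩
    · exact ⟨1, by push_cast; ring⟩
    · exact ⟨-c, by push_cast; ring⟩
    · exact ⟨0, by push_cast; ring⟩
  · intro k
    simp
  · have h1 : ∀ j : Fin 1, MvPolynomial.eval (Sum.elim (fun _ => (c : ℂ)) (Complex.exp ∘ fun _ => (c : ℂ)))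
        (pderiv (Sum.inl j) (X (Sum.inl 0) - C (c : ℂ)) +
          X (Sum.inr j) * pderiv (Sum.inr j) (X (Sum.inl 0) - C (c : ℂ)) :
            MvPolynomial (Fin 1 ⊕ Fin 1) ℂ) = 1 := by
      intro j
      simp [Subsingleton.elim j 0, pderiv_X]
    rw [Matrix.det_unique, Matrix.of_apply, h1]
    exact one_ne_zero

/-- `0` is exponentially algebraic. [cite: Kirby2010EAEF, §3 Lemma 3.3] -/
theorem isExpAlgebraic_zero : IsExpAlgebraic 0 := by
  simpa using isExpAlgebraic_intCast 0

/-- `1` is exponentially algebraic. [cite: Kirby2010EAEF, §3 Lemma 3.3] -/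
theorem isExpAlgebraic_one : IsExpAlgebraic 1 := by
  simpa using isExpAlgebraic_intCast 1

/-- Natural numbers are exponentially algebraic. [cite: Kirby2010EAEF, §3 Lemma 3.3] -/
theorem isExpAlgebraic_natCast (n : ℕ) : IsExpAlgebraic (n : ℂ) := by
  simpa using isExpAlgebraic_intCast n

/-- `E` is non-empty (it contains `0`). [cite: Kirby2010EAEF, §3 Lemma 3.3] -/
theorem expAlgebraicNumbers_nonempty : expAlgebraicNumbers.Nonempty :=
  ⟨0, isExpAlgebraic_zero⟩

/-! ### One-unknown systems (`m = 1`)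

The classical constants are put into `E` by ONE equation in ONE unknown (Kirby 2010, §3: e.g.
`πi` solves `e^z + 1 = 0`, `log 2` solves `e^z − 2 = 0`); the two lemmas below package that case
so users need not expand a `1 × 1` determinant. -/

/-- **`m = 1` introduction rule.** If `f ∈ ℂ[X, Y]` has integer coefficients, `f(a, eᵃ) = 0` and
`(∂_X f + Y·∂_Y f)(a, eᵃ) ≠ 0` (the `z`-derivative of `f(z, e^z)` at `a`), then `a` is
exponentially algebraic: `a` is the (only) coordinate of a non-degenerate solution of the
one-equation Khovanskii system `f = 0` (Kirby Def. 3.1–3.2 with `n = 1`).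
[cite: Kirby2010EAEF, §3 Def. 3.1–3.2] -/
theorem IsExpAlgebraic.of_solution_one {a : ℂ} (f : MvPolynomial (Fin 1 ⊕ Fin 1) ℂ)
    (hcoeff : ∀ mo, ∃ c : ℤ, (c : ℂ) = f.coeff mo)
    (heval :
      MvPolynomial.eval (Sum.elim (fun _ : Fin 1 => a) fun _ : Fin 1 => Complex.exp a) f = 0)
    (hder : MvPolynomial.eval (Sum.elim (fun _ : Fin 1 => a) fun _ : Fin 1 => Complex.exp a)
      (pderiv (Sum.inl 0) f + X (Sum.inr 0) * pderiv (Sum.inr 0) f) ≠ 0) :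
    IsExpAlgebraic a := by
  refine IsExpAlgebraic.of_solution (m := 1) (z := fun _ => a) (f := fun _ => f)
    (fun _ mo => hcoeff mo) (fun _ => heval) ?_ 0
  rw [Matrix.det_unique, Matrix.of_apply]
  exact hder

/-- **Every logarithm of a non-zero integer is exponentially algebraic**: if `exp a = c` with
`c ∈ ℤ ∖ {0}` then `a ∈ E`, because `a` solves `Y − c = 0` with `z`-derivative `Y = e^a = c ≠ 0`.
In particular all determinations `log c + 2πik` (so `2πik`, `πi + 2πik`, `log 2`, …) lie in `E`
with Mathlib-only imports (the general `exp`/`log`-closure of `E` is in the sibling proof file).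
[cite: Kirby2010EAEF, §3 Def. 3.1–3.2 and Lemma 3.3] -/
theorem IsExpAlgebraic.of_exp_eq_intCast {a : ℂ} {c : ℤ} (hc : c ≠ 0)
    (h : Complex.exp a = c) : IsExpAlgebraic a := by
  classical
  refine IsExpAlgebraic.of_solution_one (X (Sum.inr 0) - C (c : ℂ)) ?_ ?_ ?_
  · intro mo
    rw [coeff_sub, coeff_X, coeff_C]
    split_ifs
    · exact ⟨1 - c, by push_cast; ring⟩
    · exact ⟨1, by push_cast; ring⟩
    · exact ⟨-c, by push_cast; ring⟩
    · exact ⟨0, by push_cast; ring⟩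
  · simp [h]
  · simpa [pderiv_X, h] using hc

/-- `a ∈ E` whenever `exp a = 1`, i.e. every integer multiple of `2πi` is exponentially
algebraic (system `Y − 1 = 0`). [cite: Kirby2010EAEF, §3 Def. 3.1–3.2] -/
theorem IsExpAlgebraic.of_exp_eq_one {a : ℂ} (h : Complex.exp a = 1) : IsExpAlgebraic a :=
  IsExpAlgebraic.of_exp_eq_intCast (c := 1) one_ne_zero (by simpa using h)

end Literature.NumberTheory.Transcendental
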